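/-
Copyright (c) 2026. All rights reserved.
Released under Apache 2.0 license as described in the file LICENSE.
Authors: abc-iut cell, campaign-S prover seat abc-iut-S7.
-/
import Mathlib.LinearAlgebra.FreeModule.PID
import Mathlib.NumberTheory.Padics.RingHoms
import Literature.IUT.LogVolume.PadicBoxVolume
import Literature.IUT.LogVolume.IntegralBases
import HarnessLib

/-!
# Adapted bases: every compact open subgroup of a `p`-adic field is a box lattice `⊕ c_j ℤ_p b_j`

For `K` in the cell's norm-side MLF setting and a COMPACT OPEN additive subgroup `M ⊆ K` (e.g.
`log_p(O_K^×)`, [IUTchIV] Prop. 1.2; any `p^λ·O_K`), the elementary-divisor theorem over the PID `ℤ_p`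
(Mathlib `Submodule.exists_smith_normal_form_of_rank_eq`) gives an INTEGRAL basis `b` of `K`
(a `ℤ_p`-basis of `O_K`, as in abc-iut-S5's `IntegralBases.lean`) and `c_j ∈ ℚ_p^×` with `M = ⊕_j c_j ℤ_p b_j`, i.e.
`M = boxLattice b c` (`exists_adaptedBasis`); consequently **`μ^log_K(M) = Σ_j log ‖c_j‖`** for the Haar
measure normalised on `O_K` (`localLogVolume_eq_sum_log_of_adapted`, via `PadicBoxVolume`).  Steps: `M`
is automatically `ℤ_p`-stable (`smul_mem_of_isOpen`: `ℕ` is dense in `ℤ_p` and `M` is closed), bounded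
(`p^m·M ⊆ O_K`), and of full rank (it contains `p^{m'}·O_K`).  This is the "index of a sublattice"
bookkeeping behind the log-volume computations of [IUTchIV] Prop. 1.4 (ii)(iii) (kurims pp. 13–14),
for one field; `TensorPacketLattice.lean` tensors it.
[cite: WeilBNT1967, Ch. II §2, Th. 1] [cite: Mochizuki2012, IUTchIV Prop. 1.4 (iii) proof p. 14]
Deliberately NOT here: tensor products; anything disputed.
-/

noncomputable section

open MeasureTheory Set Metric TopologicalSpace Module Filter
open scoped NNReal ENNReal Pointwise NormedField Topology
open Literature.NumberTheory.GaloisRepresentations.Ultrametric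

namespace Literature.IUT.LogVolume

section General

variable (p : ℕ) [Fact p.Prime]
variable {K : Type*} [NontriviallyNormedField K] [instK : NormedAlgebra ℚ_[p] K]

/-! ### Compact open subgroups are bounded `ℤ_p`-lattices -/

include instK in
/-- **Open subgroups are `ℤ_p`-stable**: if `M ⊆ K` is an open (hence closed) additive subgroup, then
`c • x ∈ M` for `x ∈ M` and every `c ∈ ℚ_p` with `‖c‖ ≤ 1` — the set of such `c ∈ ℤ_p` is closed and
contains the dense subset `ℕ`. [cite: WeilBNT1967, Ch. II §2, Th. 1] -/
theorem smul_mem_of_isOpen (M : AddSubgroup K) (hMo : IsOpen (M : Set K)) {c : ℚ_[p]} (hc : ‖c‖ ≤ 1)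
    {x : K} (hx : x ∈ M) : c • x ∈ M := by
  have hclosed : IsClosed (M : Set K) := by
    have : IsClosed (((⟨M, hMo⟩ : OpenAddSubgroup K) : Set K)) := OpenAddSubgroup.isClosed _
    exact this
  let S : Set ℤ_[p] := {d | ((d : ℚ_[p]) • x) ∈ M}
  have hS : IsClosed S :=
    hclosed.preimage ((continuous_subtype_val).smul continuous_const)
  have hnat : Set.range (Nat.cast : ℕ → ℤ_[p]) ⊆ S := by
    rintro _ ⟨n, rfl⟩
    change ((n : ℤ_[p]) : ℚ_[p]) • x ∈ M
    rw [PadicInt.coe_natCast, Nat.cast_smul_eq_nsmul]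
    exact M.nsmul_mem hx n
  have hmem : (⟨c, hc⟩ : ℤ_[p]) ∈ S := by
    have := (PadicInt.denseRange_natCast (p := p)).closure_range ▸ Set.mem_univ (⟨c, hc⟩ : ℤ_[p])
    exact closure_minimal hnat hS this
  exact hmem

include instK in
/-- A compact subset is bounded by a power of `p`: `‖p^m • x‖ ≤ 1` on `M` for some `m`.
[cite: WeilBNT1967, Ch. II §2, Th. 1] -/
theorem exists_pow_smul_norm_le_one {M : Set K} (hMc : IsCompact M) :
    ∃ m : ℕ, ∀ x ∈ M, ‖((p : ℚ_[p]) ^ m) • x‖ ≤ 1 := by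
  obtain ⟨R, hR⟩ := hMc.isBounded.subset_closedBall (0 : K)
  have hp1 : (1 : ℝ) < p := by exact_mod_cast (Fact.out : p.Prime).one_lt
  obtain ⟨m, hm⟩ := pow_unbounded_of_one_lt R hp1
  refine ⟨m, fun x hx => ?_⟩
  have hxR : ‖x‖ ≤ R := by simpa using hR hx
  have hp0 : (0 : ℝ) < (p : ℝ) ^ m := pow_pos (by exact_mod_cast (Fact.out : p.Prime).pos) m
  rw [norm_smul, norm_pow, Padic.norm_p, inv_pow]
  calc ((p : ℝ) ^ m)⁻¹ * ‖x‖ ≤ ((p : ℝ) ^ m)⁻¹ * R := by gcongr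
    _ ≤ ((p : ℝ) ^ m)⁻¹ * (p : ℝ) ^ m := by gcongr
    _ = 1 := inv_mul_cancel₀ hp0.ne'

include instK in
/-- An open subgroup contains `p^{m'}·O_K` for some `m'`. [cite: WeilBNT1967, Ch. II §2, Th. 1] -/
theorem exists_pow_smul_mem_of_norm_le_one (M : AddSubgroup K) (hMo : IsOpen (M : Set K)) :
    ∃ m : ℕ, ∀ x : K, ‖x‖ ≤ 1 → ((p : ℚ_[p]) ^ m) • x ∈ M := by
  obtain ⟨ε, hε, hball⟩ := Metric.isOpen_iff.mp hMo 0 M.zero_mem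
  have hp1 : (1 : ℝ) < p := by exact_mod_cast (Fact.out : p.Prime).one_lt
  obtain ⟨m, hm⟩ := pow_unbounded_of_one_lt ε⁻¹ hp1
  refine ⟨m, fun x hx => hball ?_⟩
  rw [Metric.mem_ball, dist_zero_right, norm_smul, norm_pow, Padic.norm_p, inv_pow]
  have hp0 : (0 : ℝ) < (p : ℝ) ^ m := pow_pos (by exact_mod_cast (Fact.out : p.Prime).pos) m
  calc ((p : ℝ) ^ m)⁻¹ * ‖x‖ ≤ ((p : ℝ) ^ m)⁻¹ * 1 := by gcongr
    _ < ε := by rw [mul_one, inv_lt_comm₀ hp0 hε]; exact hm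

end General

/-! ### Smith normal form: adapted integral bases -/

variable (p : ℕ) [Fact p.Prime]
variable {K : Type*} [NontriviallyNormedField K] [instK : NormedAlgebra ℚ_[p] K] [IsUltrametricDist K]
  [ProperSpace K]

omit [ProperSpace K] in
/-- The `ℤ_p`-action on `O_K` is the `ℚ_p`-action of `K`: `↑(c • y) = (c : ℚ_p) • ↑y`.
[cite: WeilBNT1967, Ch. II §2, Th. 1] -/
theorem coe_padicInt_smul_integer (c : ℤ_[p]) (y : Valued.integer K) :
    ((c • y : Valued.integer K) : K) = (c : ℚ_[p]) • (y : K) := by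
  rw [Algebra.smul_def, Subring.coe_mul, Algebra.smul_def, ← algebraMap_padicInt_apply p K,
    IsScalarTower.algebraMap_apply ℤ_[p] (Valued.integer K) K]
  rfl

/-- The `ℤ_p`-submodule of `O_K` cut out by a `ℤ_p`-stable subgroup `M ⊆ K`.
[cite: WeilBNT1967, Ch. II §2, Th. 1] -/
def integerSubmoduleOf (M : AddSubgroup K)
    (hst : ∀ (c : ℚ_[p]), ‖c‖ ≤ 1 → ∀ x ∈ M, c • x ∈ M) : Submodule ℤ_[p] (Valued.integer K) where
  carrier := {y | (y : K) ∈ M}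
  add_mem' {a b} ha hb := by simpa using M.add_mem ha hb
  zero_mem' := by simp [M.zero_mem]
  smul_mem' c {y} hy := by
    change ((c • y : Valued.integer K) : K) ∈ M
    rw [coe_padicInt_smul_integer]
    exact hst _ (PadicInt.norm_le_one c) _ hy

omit [ProperSpace K] in
/-- Membership in `integerSubmoduleOf`. [cite: WeilBNT1967, Ch. II §2, Th. 1] -/
@[simp] theorem mem_integerSubmoduleOf (M : AddSubgroup K)
    (hst : ∀ (c : ℚ_[p]), ‖c‖ ≤ 1 → ∀ x ∈ M, c • x ∈ M) (y : Valued.integer K) :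
    y ∈ integerSubmoduleOf p M hst ↔ (y : K) ∈ M := Iff.rfl

/-- **Adapted integral bases (elementary divisors), bounded case.** For an open additive subgroup
`M ⊆ O_K` there are an integral basis `b` of `K` (its `ℤ_p`-lattice is `O_K`) and `c_j ∈ ℤ_p ∖ 0` with
`M = ⊕_j c_j ℤ_p b_j` (`= boxLattice b c`). [cite: WeilBNT1967, Ch. II §2, Th. 1] -/
theorem exists_adaptedBasis_of_subset (M : AddSubgroup K) (hMo : IsOpen (M : Set K))
    (hM1 : ∀ x ∈ M, ‖x‖ ≤ 1) :
    ∃ (n : ℕ) (bZ : Basis (Fin n) ℤ_[p] (Valued.integer K)) (b : Basis (Fin n) ℚ_[p] K)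
      (c : Fin n → ℚ_[p]ˣ), 0 < n ∧ (∀ j, b j = (bZ j : K)) ∧
      (∀ x : K, x ∈ M ↔ x ∈ PadicModule.boxLattice p b c) := by
  haveI := finiteDimensional p K
  haveI : Algebra.IsAlgebraic ℚ_[p] K := Algebra.IsAlgebraic.of_finite ℚ_[p] K
  haveI : IsLocalization (Algebra.algebraMapSubmonoid (Valued.integer K) (nonZeroDivisors ℤ_[p])) K :=
    IsIntegralClosure.isLocalization ℤ_[p] ℚ_[p] K (Valued.integer K)
  have hst : ∀ (c : ℚ_[p]), ‖c‖ ≤ 1 → ∀ x ∈ M, c • x ∈ M :=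
    fun c hc x hx => smul_mem_of_isOpen p M hMo hc hx
  let N : Submodule ℤ_[p] (Valued.integer K) := integerSubmoduleOf p M hst
  -- full rank: `p^{m'} • O_K ⊆ N ⊆ O_K`
  obtain ⟨m', hm'⟩ := exists_pow_smul_mem_of_norm_le_one p M hMo
  have hrank : finrank ℤ_[p] N = finrank ℤ_[p] (Valued.integer K) := by
    apply le_antisymm (Submodule.finrank_le N)
    let f : Valued.integer K →ₗ[ℤ_[p]] Valued.integer K :=
      DistribSMul.toLinearMap ℤ_[p] _ ((p : ℤ_[p]) ^ m')
    have hf : Function.Injective f := by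
      intro a b hab
      have hp0 : ((p : ℤ_[p]) ^ m') ≠ 0 := pow_ne_zero _ (by exact_mod_cast (Fact.out : p.Prime).ne_zero)
      exact smul_right_injective (Valued.integer K) hp0 hab
    have hrange : LinearMap.range f ≤ N := by
      rintro _ ⟨y, rfl⟩
      change (((((p : ℤ_[p]) ^ m') • y : Valued.integer K)) : K) ∈ M
      rw [coe_padicInt_smul_integer]
      push_cast
      exact hm' _ (Valued.integer.norm_le_one y)
    calc finrank ℤ_[p] (Valued.integer K) = finrank ℤ_[p] (LinearMap.range f) :=
          (LinearMap.finrank_range_of_inj hf).symm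
      _ ≤ finrank ℤ_[p] N := Submodule.finrank_mono hrange
  -- Smith normal form over the PID `ℤ_p`
  obtain ⟨b', a, ab', hab'⟩ :=
    Submodule.exists_smith_normal_form_of_rank_eq (Module.finBasis ℤ_[p] (Valued.integer K)) hrank
  have ha : ∀ j, a j ≠ 0 := fun j hj => by
    apply ab'.ne_zero j
    apply Subtype.ext
    rw [hab' j, hj, zero_smul]
    rfl
  let b : Basis (Fin (finrank ℤ_[p] (Valued.integer K))) ℚ_[p] K :=
    b'.localizationLocalization ℚ_[p] (nonZeroDivisors ℤ_[p]) K
  have hbb : ∀ j, b j = (b' j : K) := fun j =>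
    Basis.localizationLocalization_apply ℚ_[p] (nonZeroDivisors ℤ_[p]) K b' j
  have hb : ∀ x : K, x ∈ PadicModule.basisLattice p b ↔ ‖x‖ ≤ 1 := fun x =>
    (PadicModule.mem_basisLattice p b).trans
      ⟨norm_le_one_of_norm_repr_le b' b hbb, fun hx j => norm_repr_le_one b' b hbb hx j⟩
  have ha' : ∀ j, ((a j : ℤ_[p]) : ℚ_[p]) ≠ 0 := fun j h => ha j (PadicInt.coe_eq_zero.mp h)
  let c : Fin (finrank ℤ_[p] (Valued.integer K)) → ℚ_[p]ˣ := fun j => Units.mk0 (a j : ℚ_[p]) (ha' j)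
  have hc : ∀ j, ((c j : ℚ_[p]ˣ) : ℚ_[p]) = (a j : ℚ_[p]) := fun j => rfl
  -- coordinates: for `y ∈ O_K`, `b.repr y j = b'.repr y j ∈ ℤ_p`
  have hrepr : ∀ (y : Valued.integer K) (j), b.repr (y : K) j = ((b'.repr y j : ℤ_[p]) : ℚ_[p]) :=
    fun y j => Basis.localizationLocalization_repr_algebraMap ℚ_[p] (nonZeroDivisors ℤ_[p]) K b' y j
  refine ⟨_, b', b, c, ?_, hbb, fun x => ⟨fun hx => ?_, fun hx => ?_⟩⟩
  · rw [finrank_integer p K]; exact Module.finrank_pos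
  · -- `x ∈ M`: `x = Σ r_j • (a_j • b'_j)` so its `j`-th coordinate is `r_j a_j`
    rw [PadicModule.mem_boxLattice]
    intro j
    let y : Valued.integer K := ⟨x, Valued.integer.mem_iff.mpr (hM1 x hx)⟩
    have hyN : y ∈ N := hx
    let z : N := ⟨y, hyN⟩
    have h1 : (y : Valued.integer K) = ∑ i, (ab'.repr z i * a i) • b' i := by
      have h := congrArg (Submodule.subtype N) (ab'.sum_repr z).symm
      rw [map_sum] at h
      refine h.trans (Finset.sum_congr rfl fun i _ => ?_)
      rw [map_smul, Submodule.subtype_apply, hab' i, smul_smul]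
    have hy : b'.repr y j = ab'.repr z j * a j := by
      rw [h1, b'.repr_sum_self]
    rw [show x = (y : K) from rfl, hrepr, hy, hc, PadicInt.coe_mul, norm_mul]
    exact mul_le_of_le_one_left (norm_nonneg _) (PadicInt.norm_le_one _)
  · -- coordinates `d_j` with `‖d_j‖ ≤ ‖a_j‖`: `d_j = r_j a_j`, so `x = Σ r_j • ab'_j ∈ N`
    rw [PadicModule.mem_boxLattice] at hx
    have hx1 : ‖x‖ ≤ 1 := by
      refine (hb x).mp ((PadicModule.mem_basisLattice p b).mpr fun j => (hx j).trans ?_)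
      rw [hc]; exact PadicInt.norm_le_one _
    let y : Valued.integer K := ⟨x, Valued.integer.mem_iff.mpr hx1⟩
    have hdiv : ∀ j, ∃ r : ℤ_[p], b'.repr y j = r * a j := fun j => by
      have hj := hx j
      rw [show x = (y : K) from rfl, hrepr, hc] at hj
      have ha0 : ((a j : ℤ_[p]) : ℚ_[p]) ≠ 0 := ha' j
      refine ⟨⟨(b'.repr y j : ℚ_[p]) / (a j : ℚ_[p]), ?_⟩, ?_⟩
      · rw [norm_div]; exact div_le_one_of_le₀ hj (norm_nonneg _)
      · apply Subtype.ext
        push_cast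
        rw [div_mul_cancel₀ _ ha0]
    choose r hr using hdiv
    have hyN : y ∈ N := by
      have : y = ∑ j, r j • ((ab' j : N) : Valued.integer K) := by
        conv_lhs => rw [← b'.sum_repr y]
        refine Finset.sum_congr rfl fun j _ => ?_
        rw [hab' j, hr j, mul_smul]
      rw [this]
      exact N.sum_mem fun j _ => N.smul_mem _ (ab' j).2
    exact hyN

/-- **Adapted integral bases (elementary divisors).** For a COMPACT OPEN additive subgroup `M ⊆ K`
there are an integral basis `b` of `K` (its `ℤ_p`-lattice is `O_K`) and `c_j ∈ ℚ_p^×` with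
`M = ⊕_j c_j ℤ_p b_j` (`= boxLattice b c`): scale `M` into `O_K` by `p^m` and apply the bounded case.
[cite: WeilBNT1967, Ch. II §2, Th. 1] -/
theorem exists_adaptedBasis (M : AddSubgroup K) (hMo : IsOpen (M : Set K)) (hMc : IsCompact (M : Set K)) :
    ∃ (n : ℕ) (bZ : Basis (Fin n) ℤ_[p] (Valued.integer K)) (b : Basis (Fin n) ℚ_[p] K)
      (c : Fin n → ℚ_[p]ˣ), 0 < n ∧ (∀ j, b j = (bZ j : K)) ∧
      (∀ x : K, x ∈ M ↔ x ∈ PadicModule.boxLattice p b c) := by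
  obtain ⟨m, hm⟩ := exists_pow_smul_norm_le_one p hMc
  -- the scaled subgroup `p^m • M`
  let q : ℚ_[p] := (p : ℚ_[p]) ^ m
  have hq0 : q ≠ 0 := pow_ne_zero _ (Nat.cast_ne_zero.mpr (Fact.out : p.Prime).ne_zero)
  let φ : K ≃+ K := (DistribMulAction.toAddEquiv K (Units.mk0 q hq0))
  have hφ : ∀ x, φ x = q • x := fun x => rfl
  let M' : AddSubgroup K := M.map φ.toAddMonoidHom
  have hM'mem : ∀ x, x ∈ M' ↔ q⁻¹ • x ∈ M := fun x => by
    constructor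
    · rintro ⟨y, hy, rfl⟩
      change q⁻¹ • φ y ∈ M
      rwa [hφ, smul_smul, inv_mul_cancel₀ hq0, one_smul]
    · intro hx
      exact ⟨q⁻¹ • x, hx, by change φ _ = x; rw [hφ, smul_smul, mul_inv_cancel₀ hq0, one_smul]⟩
  have hM'o : IsOpen (M' : Set K) := by
    have : (M' : Set K) = (fun x => q⁻¹ • x) ⁻¹' (M : Set K) := by ext x; exact hM'mem x
    rw [this]
    exact hMo.preimage (continuous_const_smul _)
  have hM'1 : ∀ x ∈ M', ‖x‖ ≤ 1 := fun x hx => by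
    have := hm _ ((hM'mem x).mp hx)
    rwa [smul_smul, mul_inv_cancel₀ hq0, one_smul] at this
  obtain ⟨n, bZ, b, c, hn, hb, hM'⟩ := exists_adaptedBasis_of_subset p M' hM'o hM'1
  refine ⟨n, bZ, b, fun j => (Units.mk0 q hq0)⁻¹ * c j, hn, hb, fun x => ?_⟩
  have hxM : x ∈ M ↔ q • x ∈ M' := by rw [hM'mem, smul_smul, inv_mul_cancel₀ hq0, one_smul]
  rw [hxM, hM', PadicModule.mem_boxLattice, PadicModule.mem_boxLattice]
  refine forall_congr' fun j => ?_
  rw [map_smul, Finsupp.smul_apply, smul_eq_mul, norm_mul, Units.val_mul, norm_mul,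
    Units.val_inv_eq_inv_val, Units.val_mk0, norm_inv, ← div_eq_inv_mul,
    le_div_iff₀ (norm_pos_iff.mpr hq0), mul_comm]

/-- **Log-volume of a compact open subgroup from an adapted basis**: if `M = ⊕_j c_j ℤ_p b_j` for an
integral basis `b`, then `μ^log_K(M) = Σ_j log ‖c_j‖` (Haar measure normalised on `O_K`).
[cite: Mochizuki2012, IUTchIV Prop. 1.4 (iii) proof p. 14] -/
theorem localLogVolume_eq_sum_log_of_adapted [MeasurableSpace K] [BorelSpace K] {n : ℕ}
    (bZ : Basis (Fin n) ℤ_[p] (Valued.integer K)) (b : Basis (Fin n) ℚ_[p] K) (c : Fin n → ℚ_[p]ˣ)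
    (hbZ : ∀ j, b j = (bZ j : K)) (M : Set K) (hM : ∀ x : K, x ∈ M ↔ x ∈ PadicModule.boxLattice p b c) :
    localLogVolume K M = ∑ j, Real.log ‖(c j : ℚ_[p])‖ := by
  haveI := finiteDimensional p K
  haveI : IsModuleTopology ℚ_[p] K := isModuleTopologyOfFiniteDimensional
  have hb : ∀ x : K, x ∈ PadicModule.basisLattice p b ↔ ‖x‖ ≤ 1 := fun x =>
    (PadicModule.mem_basisLattice p b).trans
      ⟨norm_le_one_of_norm_repr_le bZ b hbZ, fun hx j => norm_repr_le_one bZ b hbZ hx j⟩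
  have hM' : M = (PadicModule.boxLattice p b c : Set K) := Set.ext hM
  have hΛ : ((PadicModule.basisIntegralStructure p b : IntegralStructure K) : Set K) =
      (unitBallStructure K : Set K) := by
    ext x
    rw [PadicModule.coe_basisIntegralStructure, SetLike.mem_coe, hb]
    change _ ↔ x ∈ ((unitBall K : OpenAddSubgroup K) : Set K)
    rw [SetLike.mem_coe, mem_unitBall]
  have hhaar : (unitBallStructure K).haar = (PadicModule.basisIntegralStructure p b).haar := by
    rw [(PadicModule.basisIntegralStructure p b).haar_eq_smul_haar (unitBallStructure K), ← hΛ,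
      IntegralStructure.haar_self, inv_one, one_smul]
  rw [localLogVolume, IntegralStructure.logVolume, hhaar, hM', ← IntegralStructure.logVolume,
    PadicModule.logVolume_boxLattice]

end Literature.IUT.LogVolume

end
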